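import Summits.AtomisticToContinuum.FouriersLaw.Theorems.HiddenChargeMazurDressedChargeMainReductionAux7
import Summits.AtomisticToContinuum.FouriersLaw.Theorems.HiddenChargeMazurDressedChargeStubPlaneWaveLink
import Summits.AtomisticToContinuum.FouriersLaw.Theorems.HiddenChargeMazurDressedChargeStubHarmonicSymmetries
import Summits.AtomisticToContinuum.FouriersLaw.Theorems.HiddenChargeMazurDressedChargeStubSeedObstruction

/-!
# Stub G `stub_mainReduction` of crux `DressedCharge` (line `birth`): the main reduction

Crux stmt-AtomisticToContinuum-13509 (`HiddenChargeMazur.DressedCharge`), line `birth`, stub G (lead).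
The case `n₀ = 1` of the rigidity theorem (the seed obstruction: stubs E + F through the structure theorem
of helper 5), the rigidity theorem `u = 0` for momentum-even real solutions of the linearised lattice
equation of `pinnedChain`, and the registered stub: an odd solution `G` of `L G = Ψ − τΨ` is
`C c + H − τH` (Euler operators, linearised equation, evenness, rigidity, exactness).
No definitions, no notation.
-/

noncomputable section

namespace Summit.AtomisticToContinuum.FouriersLaw.Theorems.DressedCharge

open MvPolynomial

/-- **Case `n₀ = 1`** (the seed obstruction, stubs E + F). A nonzero momentum-even real linear form `u₁`
cannot be corrected by a momentum-even cubic `u₃`: `T₀ u₃ + T₂ u₁ = 0` is impossible for `ω₂, lam > 0`. -/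
theorem case_degree_one
    (hE : ∀ (ω₂ lam β : ℝ) (a : ℤ →₀ ℂ) (u₃ : MvPolynomial (ℤ ⊕ ℤ) ℂ), u₃.totalDegree ≤ 3 →
      (MvPolynomial.mkDerivation ℂ (Sum.elim (fun i : ℤ => (MvPolynomial.X (Sum.inr i) : MvPolynomial (ℤ ⊕ ℤ) ℂ)) (fun i : ℤ => -(MvPolynomial.C ((ω₂ : ℂ) + 2) * MvPolynomial.X (Sum.inl i)) + MvPolynomial.X (Sum.inl (i + 1)) + MvPolynomial.X (Sum.inl (i - 1))))) ((MvPolynomial.mkDerivation ℂ (Sum.elim (fun i : ℤ => (MvPolynomial.X (Sum.inr i) : MvPolynomial (ℤ ⊕ ℤ) ℂ)) (fun i : ℤ => -(MvPolynomial.C ((ω₂ : ℂ) + 2) * MvPolynomial.X (Sum.inl i)) + MvPolynomial.X (Sum.inl (i + 1)) + MvPolynomial.X (Sum.inl (i - 1))))) (u₃)) + (MvPolynomial.C ((ω₂ : ℂ) + 2) * (u₃) - MvPolynomial.rename (Sum.map (fun i : ℤ => i + 1) (fun i : ℤ => i + 1)) (u₃) - MvPolynomial.rename (Sum.map (fun i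 : ℤ => i - 1) (fun i : ℤ => i - 1)) (u₃)) + ((MvPolynomial.mkDerivation ℂ (Sum.elim (fun i : ℤ => (MvPolynomial.X (Sum.inr i) : MvPolynomial (ℤ ⊕ ℤ) ℂ)) (fun i : ℤ => -(MvPolynomial.C ((ω₂ : ℂ) + 2) * MvPolynomial.X (Sum.inl i)) + MvPolynomial.X (Sum.inl (i + 1)) + MvPolynomial.X (Sum.inl (i - 1))))) ((MvPolynomial.mkDerivation ℂ (Sum.elim (fun _ : ℤ => (0 : MvPolynomial (ℤ ⊕ ℤ) ℂ)) (fun i : ℤ => -(MvPolynomial.C (lam : ℂ) * MvPolynomial.X (Sum.inl i) ^ 3) + MvPolynomial.C (β : ℂ) * (MvPolynomial.X (Sum.inl (i + 1)) - MvPolynomial.X (Sum.inl i)) ^ 3 - MvPolynomial.C (β : ℂ) * (MvPolynomial.X (Sum.inl i) - MvPolynomial.X (Sum.inl (i - 1))) ^ 3))) (a.sum (fun m c => MvPolynomial.C c * MvPolynomial.X (Sum.inl m)))) + (MvPolynomial.mkDerivation ℂ (Sum.elim (fun _ : ℤ => (0 : MvPolynomial (ℤ ⊕ ℤ) ℂ))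 (fun i : ℤ => -(MvPolynomial.C (lam : ℂ) * MvPolynomial.X (Sum.inl i) ^ 3) + MvPolynomial.C (β : ℂ) * (MvPolynomial.X (Sum.inl (i + 1)) - MvPolynomial.X (Sum.inl i)) ^ 3 - MvPolynomial.C (β : ℂ) * (MvPolynomial.X (Sum.inl i) - MvPolynomial.X (Sum.inl (i - 1))) ^ 3))) ((MvPolynomial.mkDerivation ℂ (Sum.elim (fun i : ℤ => (MvPolynomial.X (Sum.inr i) : MvPolynomial (ℤ ⊕ ℤ) ℂ)) (fun i : ℤ => -(MvPolynomial.C ((ω₂ : ℂ) + 2) * MvPolynomial.X (Sum.inl i)) + MvPolynomial.X (Sum.inl (i + 1)) + MvPolynomial.X (Sum.inl (i - 1))))) (a.sum (fun m c => MvPolynomial.C c * MvPolynomial.X (Sum.inl m)))) + ((MvPolynomial.C (3 * (lam : ℂ)) * MvPolynomial.X (Sum.inl 0) ^ 2 + MvPolynomial.C (3 * (β : ℂ)) * (MvPolynomial.X (Sum.inl 1) - MvPolynomial.X (Sum.inl 0)) ^ 2 + MvPolynomial.C (3 * (β : ℂ)) * (MvPolynomial.X (Sum.inl 0) - MvPolynomial.X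 (Sum.inl (-1))) ^ 2) * (a.sum (fun m c => MvPolynomial.C c * MvPolynomial.X (Sum.inl m))) - MvPolynomial.C (3 * (β : ℂ)) * (MvPolynomial.X (Sum.inl 1) - MvPolynomial.X (Sum.inl 0)) ^ 2 * MvPolynomial.rename (Sum.map (fun i : ℤ => i + 1) (fun i : ℤ => i + 1)) (a.sum (fun m c => MvPolynomial.C c * MvPolynomial.X (Sum.inl m))) - MvPolynomial.C (3 * (β : ℂ)) * (MvPolynomial.X (Sum.inl 0) - MvPolynomial.X (Sum.inl (-1))) ^ 2 * MvPolynomial.rename (Sum.map (fun i : ℤ => i - 1) (fun i : ℤ => i - 1)) (a.sum (fun m c => MvPolynomial.C c * MvPolynomial.X (Sum.inl m))))) = 0 →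
      ∀ P : Fin 3 → ℂ × ℂ, (∀ j, (P j).1 ≠ 0 ∧ (P j).2 ^ 2 = -((ω₂ : ℂ) + 2 - (P j).1 - ((P j).1)⁻¹)) →
        ((∑ j, (P j).2) ^ 2 + ((ω₂ : ℂ) + 2 - (∏ j, (P j).1) - (∏ j, (P j).1)⁻¹)) * MvPolynomial.constantCoeff ((List.ofFn P).foldr (fun (Pj : ℂ × ℂ) (acc : MvPolynomial (ℤ ⊕ ℤ) ℂ) => MvPolynomial.mkDerivation ℂ (Sum.elim (fun x : ℤ => (MvPolynomial.C (Pj.1 ^ x) : MvPolynomial (ℤ ⊕ ℤ) ℂ)) (fun x : ℤ => MvPolynomial.C (Pj.2 * Pj.1 ^ x))) acc) (u₃)) =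
          -(6 * (-(lam : ℂ) + (β : ℂ) * ∏ j, ((P j).1 - 1) - (β : ℂ) * ∏ j, (1 - ((P j).1)⁻¹))) *
            (a.sum (fun m c => c * (∏ j, (P j).1) ^ m) - ∑ j, a.sum (fun m c => c * ((P j).1) ^ m)))
    (hF : ∀ (ω₂ : ℝ), 0 < ω₂ → ∀ (K : ℂ), K ≠ 0 → ∀ (a : ℤ →₀ ℂ), a ≠ 0 →
    ∀ c0 c12 c13 c23 : ℂ → ℂ → ℂ,
      (∀ f ∈ [c0, c12, c13, c23], ∃ (N : ℕ) (p : MvPolynomial (Fin 2) ℂ), ∀ z₁ z₂ : ℂ, z₁ ≠ 0 → z₂ ≠ 0 →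
          f z₁ z₂ * (z₁ * z₂) ^ N = MvPolynomial.eval ![z₁, z₂] p) →
      (∀ z₁ z₂ μ₁ μ₂ μ₃ : ℂ, z₁ ≠ 0 → z₂ ≠ 0 →
          μ₁ ^ 2 = -((ω₂ : ℂ) + 2 - (z₁) - (z₁)⁻¹) → μ₂ ^ 2 = -((ω₂ : ℂ) + 2 - (z₂) - (z₂)⁻¹) → μ₃ ^ 2 = -(ω₂ : ℂ) →
          ((μ₁ + μ₂ + μ₃) ^ 2 + ((ω₂ : ℂ) + 2 - (z₁ * z₂) - (z₁ * z₂)⁻¹)) *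
              (c0 z₁ z₂ + μ₁ * μ₂ * c12 z₁ z₂ + μ₁ * μ₃ * c13 z₁ z₂ + μ₂ * μ₃ * c23 z₁ z₂) =
            K * (a.sum (fun m c => c * (z₁ * z₂) ^ m) - a.sum (fun m c => c * (z₁) ^ m) - a.sum (fun m c => c * (z₂) ^ m) - a.sum (fun m c => c * ((1 : ℂ)) ^ m))) →
      False)
    (ω₂ lam β : ℝ) (hω : 0 < ω₂) (hl : 0 < lam) (u₁ u₃ : MvPolynomial (ℤ ⊕ ℤ) ℝ)
    (hu₁ : u₁.IsHomogeneous 1) (hu₃ : u₃.IsHomogeneous 3)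
    (he₁ : MvPolynomial.aeval (R := ℝ) (Sum.elim (fun i : ℤ => (X (Sum.inl i) : MvPolynomial (ℤ ⊕ ℤ) ℝ)) (fun i : ℤ => -X (Sum.inr i))) u₁ = u₁) (he₃ : MvPolynomial.aeval (R := ℝ) (Sum.elim (fun i : ℤ => (X (Sum.inl i) : MvPolynomial (ℤ ⊕ ℤ) ℝ)) (fun i : ℤ => -X (Sum.inr i))) u₃ = u₃) (hne : u₁ ≠ 0)
    (h : ((MvPolynomial.mkDerivation ℝ (Sum.elim (fun i : ℤ => (X (Sum.inr i) : MvPolynomial (ℤ ⊕ ℤ) ℝ)) (fun i : ℤ => -(C (ω₂ + 2) * X (Sum.inl i)) + X (Sum.inl (i + 1)) + X (Sum.inl (i - 1))))) ((MvPolynomial.mkDerivation ℝ (Sum.elim (fun i : ℤ => (X (Sum.inr i) : MvPolynomial (ℤ ⊕ ℤ) ℝ)) (fun i : ℤ => -(C (ω₂ + 2) * X (Sum.inl i)) + X (Sum.inl (i + 1)) + X (Sum.inl (i - 1))))) (u₃)) + (C (ω₂ + 2) * (u₃) - rename (Sum.map (fun i : ℤ => i + 1) (fun i : ℤ => i + 1))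 (u₃) - rename (Sum.map (fun i : ℤ => i + -1) (fun i : ℤ => i + -1)) (u₃))) + ((MvPolynomial.mkDerivation ℝ (Sum.elim (fun i : ℤ => (X (Sum.inr i) : MvPolynomial (ℤ ⊕ ℤ) ℝ)) (fun i : ℤ => -(C (ω₂ + 2) * X (Sum.inl i)) + X (Sum.inl (i + 1)) + X (Sum.inl (i - 1))))) ((MvPolynomial.mkDerivation ℝ (Sum.elim (fun _ : ℤ => (0 : MvPolynomial (ℤ ⊕ ℤ) ℝ)) (fun i : ℤ => -(C lam * X (Sum.inl i) ^ 3) + C β * (X (Sum.inl (i + 1)) - X (Sum.inl i)) ^ 3 - C β * (X (Sum.inl i) - X (Sum.inl (i - 1))) ^ 3))) (u₁)) + (MvPolynomial.mkDerivation ℝ (Sum.elim (fun _ : ℤ => (0 : MvPolynomial (ℤ ⊕ ℤ) ℝ)) (fun i : ℤ => -(C lam * X (Sum.inl i) ^ 3) + C β * (X (Sum.inl (i + 1)) - X (Sum.inl i)) ^ 3 - C β * (X (Sum.inl i) - X (Sum.inl (i - 1))) ^ 3))) ((MvPolynomial.mkDerivation ℝ (Sum.elim (fun i : ℤ => (X (Sum.inr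 i) : MvPolynomial (ℤ ⊕ ℤ) ℝ)) (fun i : ℤ => -(C (ω₂ + 2) * X (Sum.inl i)) + X (Sum.inl (i + 1)) + X (Sum.inl (i - 1))))) (u₁)) + ((C (3 * lam) * X (Sum.inl 0) ^ 2 + C (3 * β) * (X (Sum.inl 1) - X (Sum.inl 0)) ^ 2 + C (3 * β) * (X (Sum.inl 0) - X (Sum.inl (-1))) ^ 2) * (u₁) - C (3 * β) * (X (Sum.inl 1) - X (Sum.inl 0)) ^ 2 * rename (Sum.map (fun i : ℤ => i + 1) (fun i : ℤ => i + 1)) (u₁) - C (3 * β) * (X (Sum.inl 0) - X (Sum.inl (-1))) ^ 2 * rename (Sum.map (fun i : ℤ => i + -1) (fun i : ℤ => i + -1)) (u₁))) = 0) : False := by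
  classical
  -- the seed coefficient function
  obtain ⟨a, ha⟩ := even_linear_form u₁ hu₁ he₁
  have ha0 : a ≠ 0 := ne_zero_of_sum_ne_zero a u₁ ha hne
  set aC : ℤ →₀ ℂ := a.mapRange Complex.ofReal Complex.ofReal_zero with haC_def
  have haC : aC ≠ 0 := by
    intro h0
    apply ha0
    ext m
    have := DFunLike.congr_fun h0 m
    simpa [haC_def] using this
  -- base change
  set u3c : MvPolynomial (ℤ ⊕ ℤ) ℂ := MvPolynomial.map Complex.ofRealHom u₃ with hu3c
  have hu1c : MvPolynomial.map Complex.ofRealHom u₁ = aC.sum (fun m c => MvPolynomial.C c * MvPolynomial.X (Sum.inl m)) := by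
    rw [ha, map_finsuppSum, haC_def, Finsupp.sum_mapRange_index (fun m => by simp)]
    refine Finsupp.sum_congr fun m _ => ?_
    rw [map_mul, map_C, map_X, Complex.ofRealHom_eq_coe]
  have hD2 : (MvPolynomial.mkDerivation ℂ (Sum.elim (fun i : ℤ => (MvPolynomial.X (Sum.inr i) : MvPolynomial (ℤ ⊕ ℤ) ℂ)) (fun i : ℤ => -(MvPolynomial.C ((ω₂ : ℂ) + 2) * MvPolynomial.X (Sum.inl i)) + MvPolynomial.X (Sum.inl (i + 1)) + MvPolynomial.X (Sum.inl (i - 1))))) ((MvPolynomial.mkDerivation ℂ (Sum.elim (fun i : ℤ => (MvPolynomial.X (Sum.inr i) : MvPolynomial (ℤ ⊕ ℤ) ℂ)) (fun i : ℤ => -(MvPolynomial.C ((ω₂ : ℂ) + 2) * MvPolynomial.X (Sum.inl i)) + MvPolynomial.X (Sum.inl (i + 1)) + MvPolynomial.X (Sum.inl (i - 1))))) (u3c)) + (MvPolynomial.C ((ω₂ : ℂ) + 2) * (u3c) - MvPolynomial.rename (Sum.map (fun i : ℤ => i + 1) (fun i : ℤ => i + 1)) (u3c) - MvPolynomial.rename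 (Sum.map (fun i : ℤ => i - 1) (fun i : ℤ => i - 1)) (u3c)) + ((MvPolynomial.mkDerivation ℂ (Sum.elim (fun i : ℤ => (MvPolynomial.X (Sum.inr i) : MvPolynomial (ℤ ⊕ ℤ) ℂ)) (fun i : ℤ => -(MvPolynomial.C ((ω₂ : ℂ) + 2) * MvPolynomial.X (Sum.inl i)) + MvPolynomial.X (Sum.inl (i + 1)) + MvPolynomial.X (Sum.inl (i - 1))))) ((MvPolynomial.mkDerivation ℂ (Sum.elim (fun _ : ℤ => (0 : MvPolynomial (ℤ ⊕ ℤ) ℂ)) (fun i : ℤ => -(MvPolynomial.C (lam : ℂ) * MvPolynomial.X (Sum.inl i) ^ 3) + MvPolynomial.C (β : ℂ) * (MvPolynomial.X (Sum.inl (i + 1)) - MvPolynomial.X (Sum.inl i)) ^ 3 - MvPolynomial.C (β : ℂ) * (MvPolynomial.X (Sum.inl i) - MvPolynomial.X (Sum.inl (i - 1))) ^ 3))) (aC.sum (fun m c => MvPolynomial.C c * MvPolynomial.X (Sum.inl m)))) + (MvPolynomial.mkDerivation ℂ (Sum.elim (fun _ : ℤ => (0 : MvPolynomial (ℤ ⊕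 ℤ) ℂ)) (fun i : ℤ => -(MvPolynomial.C (lam : ℂ) * MvPolynomial.X (Sum.inl i) ^ 3) + MvPolynomial.C (β : ℂ) * (MvPolynomial.X (Sum.inl (i + 1)) - MvPolynomial.X (Sum.inl i)) ^ 3 - MvPolynomial.C (β : ℂ) * (MvPolynomial.X (Sum.inl i) - MvPolynomial.X (Sum.inl (i - 1))) ^ 3))) ((MvPolynomial.mkDerivation ℂ (Sum.elim (fun i : ℤ => (MvPolynomial.X (Sum.inr i) : MvPolynomial (ℤ ⊕ ℤ) ℂ)) (fun i : ℤ => -(MvPolynomial.C ((ω₂ : ℂ) + 2) * MvPolynomial.X (Sum.inl i)) + MvPolynomial.X (Sum.inl (i + 1)) + MvPolynomial.X (Sum.inl (i - 1))))) (aC.sum (fun m c => MvPolynomial.C c * MvPolynomial.X (Sum.inl m)))) + ((MvPolynomial.C (3 * (lam : ℂ)) * MvPolynomial.X (Sum.inl 0) ^ 2 + MvPolynomial.C (3 * (β : ℂ)) * (MvPolynomial.X (Sum.inl 1) - MvPolynomial.X (Sum.inl 0)) ^ 2 + MvPolynomial.C (3 * (β : ℂ)) * (MvPolynomial.X (Sum.inl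 0) - MvPolynomial.X (Sum.inl (-1))) ^ 2) * (aC.sum (fun m c => MvPolynomial.C c * MvPolynomial.X (Sum.inl m))) - MvPolynomial.C (3 * (β : ℂ)) * (MvPolynomial.X (Sum.inl 1) - MvPolynomial.X (Sum.inl 0)) ^ 2 * MvPolynomial.rename (Sum.map (fun i : ℤ => i + 1) (fun i : ℤ => i + 1)) (aC.sum (fun m c => MvPolynomial.C c * MvPolynomial.X (Sum.inl m))) - MvPolynomial.C (3 * (β : ℂ)) * (MvPolynomial.X (Sum.inl 0) - MvPolynomial.X (Sum.inl (-1))) ^ 2 * MvPolynomial.rename (Sum.map (fun i : ℤ => i - 1) (fun i : ℤ => i - 1)) (aC.sum (fun m c => MvPolynomial.C c * MvPolynomial.X (Sum.inl m))))) = 0 := by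
    have := congrArg (MvPolynomial.map Complex.ofRealHom) h
    simp only [map_add (MvPolynomial.map Complex.ofRealHom), map_sub (MvPolynomial.map Complex.ofRealHom),
      map_mul (MvPolynomial.map Complex.ofRealHom), map_pow (MvPolynomial.map Complex.ofRealHom),
      mapC_liouville1, mapC_liouville3, map_rename, map_C, map_X, map_zero, hu1c,
      Complex.ofRealHom_eq_coe, Complex.ofReal_add, Complex.ofReal_mul, Complex.ofReal_ofNat] at this
    exact this
  have he3c : MvPolynomial.aeval (R := ℂ) (Sum.elim (fun i : ℤ => (X (Sum.inl i) : MvPolynomial (ℤ ⊕ ℤ) ℂ))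
      (fun i : ℤ => -X (Sum.inr i))) u3c = u3c := by
    rw [hu3c, ← map_theta, he₃]
  have hEi := hE ω₂ lam β aC u3c (hu₃.map _).totalDegree_le hD2
  obtain ⟨c0, c12, c13, c23, hLaur, hstruct⟩ := planeWave3_even_structure u3c he3c
  have hK : (6 * (lam : ℂ)) ≠ 0 := mul_ne_zero (by norm_num) (Complex.ofReal_ne_zero.mpr hl.ne')
  refine hF ω₂ hω (6 * (lam : ℂ)) hK aC haC c0 c12 c13 c23 hLaur fun z₁ z₂ μ₁ μ₂ μ₃ hz₁ hz₂ hμ₁ hμ₂ hμ₃ => ?_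
  have hP := hEi ![(z₁, μ₁), (z₂, μ₂), ((1 : ℂ), μ₃)] (by
    intro j
    fin_cases j
    · exact ⟨hz₁, hμ₁⟩
    · exact ⟨hz₂, hμ₂⟩
    · refine ⟨by simp, ?_⟩
      simp only [hμ₃, Fin.reduceFinMk, Matrix.cons_val, inv_one]
      ring)
  rw [seedLink_fold_three] at hP
  simp only [Fin.sum_univ_three, Fin.prod_univ_three, Matrix.cons_val_zero, Matrix.cons_val_one, Matrix.cons_val_two,
    Matrix.head_cons, Matrix.tail_cons, one_zpow, mul_one, map_one, sub_self, mul_zero, inv_one, sub_zero, add_zero] at hP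
  rw [hstruct z₁ z₂ μ₁ μ₂ μ₃] at hP
  simp only [one_zpow, mul_one]
  linear_combination hP


/-- **Rigidity.** Given the four spectral stubs C–F, for `ω₂, lam > 0` a momentum-even real lattice
polynomial `u` solving the linearised equation `L (L u) + (W₀₀ u + W₀₁ τu + W₀₋₁ τ⁻¹ u) = 0` vanishes. -/
theorem linearised_rigidity
    (hC : ∀ (ω₂ : ℝ) (n : ℕ) (w : MvPolynomial (ℤ ⊕ ℤ) ℂ), w.totalDegree ≤ n →
    ∀ P : Fin n → ℂ × ℂ, (∀ j, (P j).1 ≠ 0 ∧ (P j).2 ^ 2 = -((ω₂ : ℂ) + 2 - (P j).1 - ((P j).1)⁻¹)) →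
      MvPolynomial.constantCoeff ((List.ofFn P).foldr (fun (Pj : ℂ × ℂ) (acc : MvPolynomial (ℤ ⊕ ℤ) ℂ) => MvPolynomial.mkDerivation ℂ (Sum.elim (fun x : ℤ => (MvPolynomial.C (Pj.1 ^ x) : MvPolynomial (ℤ ⊕ ℤ) ℂ)) (fun x : ℤ => MvPolynomial.C (Pj.2 * Pj.1 ^ x))) acc) ((MvPolynomial.mkDerivation ℂ (Sum.elim (fun i : ℤ => (MvPolynomial.X (Sum.inr i) : MvPolynomial (ℤ ⊕ ℤ) ℂ)) (fun i : ℤ => -(MvPolynomial.C ((ω₂ : ℂ) + 2) * MvPolynomial.X (Sum.inl i)) + MvPolynomial.X (Sum.inl (i + 1)) + MvPolynomial.X (Sum.inl (i - 1))))) ((MvPolynomial.mkDerivation ℂ (Sum.elim (fun i : ℤ => (MvPolynomial.X (Sum.inr i) : MvPolynomial (ℤ ⊕ ℤ) ℂ)) (fun i : ℤ => -(MvPolynomial.C ((ω₂ : ℂ) + 2) * MvPolynomial.X (Sum.inl i)) + MvPolynomial.X (Sum.inl (i + 1)) + MvPolynomial.X (Sum.inl (i - 1))))) (w)) + (MvPolynomial.C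 ((ω₂ : ℂ) + 2) * (w) - MvPolynomial.rename (Sum.map (fun i : ℤ => i + 1) (fun i : ℤ => i + 1)) (w) - MvPolynomial.rename (Sum.map (fun i : ℤ => i - 1) (fun i : ℤ => i - 1)) (w)))) =
        ((∑ j, (P j).2) ^ 2 + ((ω₂ : ℂ) + 2 - (∏ j, (P j).1) - (∏ j, (P j).1)⁻¹)) * MvPolynomial.constantCoeff ((List.ofFn P).foldr (fun (Pj : ℂ × ℂ) (acc : MvPolynomial (ℤ ⊕ ℤ) ℂ) => MvPolynomial.mkDerivation ℂ (Sum.elim (fun x : ℤ => (MvPolynomial.C (Pj.1 ^ x) : MvPolynomial (ℤ ⊕ ℤ) ℂ)) (fun x : ℤ => MvPolynomial.C (Pj.2 * Pj.1 ^ x))) acc) (w)))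
    (hD : ∀ (ω₂ : ℝ), ω₂ ≠ 0 → ∀ (n : ℕ), 2 ≤ n → ∀ (w : MvPolynomial (ℤ ⊕ ℤ) ℂ), w.IsHomogeneous n →
      (∀ P : Fin n → ℂ × ℂ, (∀ j, (P j).1 ≠ 0 ∧ (P j).2 ^ 2 = -((ω₂ : ℂ) + 2 - (P j).1 - ((P j).1)⁻¹)) →
        ((∑ j, (P j).2) ^ 2 + ((ω₂ : ℂ) + 2 - (∏ j, (P j).1) - (∏ j, (P j).1)⁻¹)) * MvPolynomial.constantCoeff ((List.ofFn P).foldr (fun (Pj : ℂ × ℂ) (acc : MvPolynomial (ℤ ⊕ ℤ) ℂ) => MvPolynomial.mkDerivation ℂ (Sum.elim (fun x : ℤ => (MvPolynomial.C (Pj.1 ^ x) : MvPolynomial (ℤ ⊕ ℤ) ℂ)) (fun x : ℤ => MvPolynomial.C (Pj.2 * Pj.1 ^ x))) acc) (w)) = 0) →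
      w = 0)
    (hE : ∀ (ω₂ lam β : ℝ) (a : ℤ →₀ ℂ) (u₃ : MvPolynomial (ℤ ⊕ ℤ) ℂ), u₃.totalDegree ≤ 3 →
      (MvPolynomial.mkDerivation ℂ (Sum.elim (fun i : ℤ => (MvPolynomial.X (Sum.inr i) : MvPolynomial (ℤ ⊕ ℤ) ℂ)) (fun i : ℤ => -(MvPolynomial.C ((ω₂ : ℂ) + 2) * MvPolynomial.X (Sum.inl i)) + MvPolynomial.X (Sum.inl (i + 1)) + MvPolynomial.X (Sum.inl (i - 1))))) ((MvPolynomial.mkDerivation ℂ (Sum.elim (fun i : ℤ => (MvPolynomial.X (Sum.inr i) : MvPolynomial (ℤ ⊕ ℤ) ℂ)) (fun i : ℤ => -(MvPolynomial.C ((ω₂ : ℂ) + 2) * MvPolynomial.X (Sum.inl i)) + MvPolynomial.X (Sum.inl (i + 1)) + MvPolynomial.X (Sum.inl (i - 1))))) (u₃)) + (MvPolynomial.C ((ω₂ : ℂ) + 2) * (u₃) - MvPolynomial.rename (Sum.map (fun i : ℤ => i + 1) (fun i : ℤ => i + 1)) (u₃) - MvPolynomial.rename (Sum.map (fun i : ℤ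 => i - 1) (fun i : ℤ => i - 1)) (u₃)) + ((MvPolynomial.mkDerivation ℂ (Sum.elim (fun i : ℤ => (MvPolynomial.X (Sum.inr i) : MvPolynomial (ℤ ⊕ ℤ) ℂ)) (fun i : ℤ => -(MvPolynomial.C ((ω₂ : ℂ) + 2) * MvPolynomial.X (Sum.inl i)) + MvPolynomial.X (Sum.inl (i + 1)) + MvPolynomial.X (Sum.inl (i - 1))))) ((MvPolynomial.mkDerivation ℂ (Sum.elim (fun _ : ℤ => (0 : MvPolynomial (ℤ ⊕ ℤ) ℂ)) (fun i : ℤ => -(MvPolynomial.C (lam : ℂ) * MvPolynomial.X (Sum.inl i) ^ 3) + MvPolynomial.C (β : ℂ) * (MvPolynomial.X (Sum.inl (i + 1)) - MvPolynomial.X (Sum.inl i)) ^ 3 - MvPolynomial.C (β : ℂ) * (MvPolynomial.X (Sum.inl i) - MvPolynomial.X (Sum.inl (i - 1))) ^ 3))) (a.sum (fun m c => MvPolynomial.C c * MvPolynomial.X (Sum.inl m)))) + (MvPolynomial.mkDerivation ℂ (Sum.elim (fun _ : ℤ => (0 : MvPolynomial (ℤ ⊕ ℤ) ℂ)) (fun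 i : ℤ => -(MvPolynomial.C (lam : ℂ) * MvPolynomial.X (Sum.inl i) ^ 3) + MvPolynomial.C (β : ℂ) * (MvPolynomial.X (Sum.inl (i + 1)) - MvPolynomial.X (Sum.inl i)) ^ 3 - MvPolynomial.C (β : ℂ) * (MvPolynomial.X (Sum.inl i) - MvPolynomial.X (Sum.inl (i - 1))) ^ 3))) ((MvPolynomial.mkDerivation ℂ (Sum.elim (fun i : ℤ => (MvPolynomial.X (Sum.inr i) : MvPolynomial (ℤ ⊕ ℤ) ℂ)) (fun i : ℤ => -(MvPolynomial.C ((ω₂ : ℂ) + 2) * MvPolynomial.X (Sum.inl i)) + MvPolynomial.X (Sum.inl (i + 1)) + MvPolynomial.X (Sum.inl (i - 1))))) (a.sum (fun m c => MvPolynomial.C c * MvPolynomial.X (Sum.inl m)))) + ((MvPolynomial.C (3 * (lam : ℂ)) * MvPolynomial.X (Sum.inl 0) ^ 2 + MvPolynomial.C (3 * (β : ℂ)) * (MvPolynomial.X (Sum.inl 1) - MvPolynomial.X (Sum.inl 0)) ^ 2 + MvPolynomial.C (3 * (β : ℂ)) * (MvPolynomial.X (Sum.inl 0) - MvPolynomial.X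 (Sum.inl (-1))) ^ 2) * (a.sum (fun m c => MvPolynomial.C c * MvPolynomial.X (Sum.inl m))) - MvPolynomial.C (3 * (β : ℂ)) * (MvPolynomial.X (Sum.inl 1) - MvPolynomial.X (Sum.inl 0)) ^ 2 * MvPolynomial.rename (Sum.map (fun i : ℤ => i + 1) (fun i : ℤ => i + 1)) (a.sum (fun m c => MvPolynomial.C c * MvPolynomial.X (Sum.inl m))) - MvPolynomial.C (3 * (β : ℂ)) * (MvPolynomial.X (Sum.inl 0) - MvPolynomial.X (Sum.inl (-1))) ^ 2 * MvPolynomial.rename (Sum.map (fun i : ℤ => i - 1) (fun i : ℤ => i - 1)) (a.sum (fun m c => MvPolynomial.C c * MvPolynomial.X (Sum.inl m))))) = 0 →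
      ∀ P : Fin 3 → ℂ × ℂ, (∀ j, (P j).1 ≠ 0 ∧ (P j).2 ^ 2 = -((ω₂ : ℂ) + 2 - (P j).1 - ((P j).1)⁻¹)) →
        ((∑ j, (P j).2) ^ 2 + ((ω₂ : ℂ) + 2 - (∏ j, (P j).1) - (∏ j, (P j).1)⁻¹)) * MvPolynomial.constantCoeff ((List.ofFn P).foldr (fun (Pj : ℂ × ℂ) (acc : MvPolynomial (ℤ ⊕ ℤ) ℂ) => MvPolynomial.mkDerivation ℂ (Sum.elim (fun x : ℤ => (MvPolynomial.C (Pj.1 ^ x) : MvPolynomial (ℤ ⊕ ℤ) ℂ)) (fun x : ℤ => MvPolynomial.C (Pj.2 * Pj.1 ^ x))) acc) (u₃)) =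
          -(6 * (-(lam : ℂ) + (β : ℂ) * ∏ j, ((P j).1 - 1) - (β : ℂ) * ∏ j, (1 - ((P j).1)⁻¹))) *
            (a.sum (fun m c => c * (∏ j, (P j).1) ^ m) - ∑ j, a.sum (fun m c => c * ((P j).1) ^ m)))
    (hF : ∀ (ω₂ : ℝ), 0 < ω₂ → ∀ (K : ℂ), K ≠ 0 → ∀ (a : ℤ →₀ ℂ), a ≠ 0 →
    ∀ c0 c12 c13 c23 : ℂ → ℂ → ℂ,
      (∀ f ∈ [c0, c12, c13, c23], ∃ (N : ℕ) (p : MvPolynomial (Fin 2) ℂ), ∀ z₁ z₂ : ℂ, z₁ ≠ 0 → z₂ ≠ 0 →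
          f z₁ z₂ * (z₁ * z₂) ^ N = MvPolynomial.eval ![z₁, z₂] p) →
      (∀ z₁ z₂ μ₁ μ₂ μ₃ : ℂ, z₁ ≠ 0 → z₂ ≠ 0 →
          μ₁ ^ 2 = -((ω₂ : ℂ) + 2 - (z₁) - (z₁)⁻¹) → μ₂ ^ 2 = -((ω₂ : ℂ) + 2 - (z₂) - (z₂)⁻¹) → μ₃ ^ 2 = -(ω₂ : ℂ) →
          ((μ₁ + μ₂ + μ₃) ^ 2 + ((ω₂ : ℂ) + 2 - (z₁ * z₂) - (z₁ * z₂)⁻¹)) *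
              (c0 z₁ z₂ + μ₁ * μ₂ * c12 z₁ z₂ + μ₁ * μ₃ * c13 z₁ z₂ + μ₂ * μ₃ * c23 z₁ z₂) =
            K * (a.sum (fun m c => c * (z₁ * z₂) ^ m) - a.sum (fun m c => c * (z₁) ^ m) - a.sum (fun m c => c * (z₂) ^ m) - a.sum (fun m c => c * ((1 : ℂ)) ^ m))) →
      False)
    (ω₂ lam β : ℝ) (hω : 0 < ω₂) (hl : 0 < lam) (u : MvPolynomial (ℤ ⊕ ℤ) ℝ)
    (heven : MvPolynomial.aeval (R := ℝ) (Sum.elim (fun i : ℤ => (X (Sum.inl i) : MvPolynomial (ℤ ⊕ ℤ) ℝ)) (fun i : ℤ => -X (Sum.inr i))) u = u)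
    (hlin : (MvPolynomial.mkDerivation ℝ (Sum.elim (fun i : ℤ => (MvPolynomial.X (Sum.inr i) : MvPolynomial (ℤ ⊕ ℤ) ℝ)) (fun i : ℤ => -(MvPolynomial.C ω₂ * MvPolynomial.X (Sum.inl i) + MvPolynomial.C lam * MvPolynomial.X (Sum.inl i) ^ 3) + ((MvPolynomial.X (Sum.inl (i + 1)) - MvPolynomial.X (Sum.inl i)) + MvPolynomial.C β * (MvPolynomial.X (Sum.inl (i + 1)) - MvPolynomial.X (Sum.inl i)) ^ 3) - ((MvPolynomial.X (Sum.inl i) - MvPolynomial.X (Sum.inl (i - 1))) + MvPolynomial.C β * (MvPolynomial.X (Sum.inl i) - MvPolynomial.X (Sum.inl (i - 1))) ^ 3)))) ((MvPolynomial.mkDerivation ℝ (Sum.elim (fun i : ℤ => (MvPolynomial.X (Sum.inr i) : MvPolynomial (ℤ ⊕ ℤ) ℝ)) (fun i : ℤ => -(MvPolynomial.C ω₂ * MvPolynomial.X (Sum.inl i) + MvPolynomial.C lam * MvPolynomial.X (Sum.inl i) ^ 3) + ((MvPolynomial.X (Sum.inl (i + 1)) - MvPolynomial.X (Sum.inl i))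 + MvPolynomial.C β * (MvPolynomial.X (Sum.inl (i + 1)) - MvPolynomial.X (Sum.inl i)) ^ 3) - ((MvPolynomial.X (Sum.inl i) - MvPolynomial.X (Sum.inl (i - 1))) + MvPolynomial.C β * (MvPolynomial.X (Sum.inl i) - MvPolynomial.X (Sum.inl (i - 1))) ^ 3)))) u) + ((MvPolynomial.C ω₂ + MvPolynomial.C (3 * lam) * MvPolynomial.X (Sum.inl 0) ^ 2 + (1 + MvPolynomial.C (3 * β) * (MvPolynomial.X (Sum.inl 1) - MvPolynomial.X (Sum.inl 0)) ^ 2) + (1 + MvPolynomial.C (3 * β) * (MvPolynomial.X (Sum.inl 0) - MvPolynomial.X (Sum.inl (-1))) ^ 2)) * u + -(1 + MvPolynomial.C (3 * β) * (MvPolynomial.X (Sum.inl 1) - MvPolynomial.X (Sum.inl 0)) ^ 2) * MvPolynomial.rename (Sum.map (fun i : ℤ => i + 1) (fun i : ℤ => i + 1)) (u) + -(1 + MvPolynomial.C (3 * β) * (MvPolynomial.X (Sum.inl 0) - MvPolynomial.X (Sum.inl (-1))) ^ 2) * MvPolynomial.rename (Sum.map (fun i : ℤ => i + -1) (fun i :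 ℤ => i + -1)) (u)) = 0) : u = 0 := by
  classical
  by_contra hu0
  have hsplit := linearised_split ω₂ lam β u hlin
  -- the lowest nonzero homogeneous component
  have hex : ∃ n, homogeneousComponent n u ≠ 0 := by
    by_contra hall
    push Not at hall
    apply hu0
    rw [← sum_homogeneousComponent u]
    exact Finset.sum_eq_zero fun n _ => hall n
  have hn₀ : homogeneousComponent (Nat.find hex) u ≠ 0 := Nat.find_spec hex
  have hmin : ∀ k < Nat.find hex, homogeneousComponent k u = 0 := fun k hk => by
    by_contra h; exact Nat.find_min hex hk h
  have hevn : ∀ n, MvPolynomial.aeval (R := ℝ) (Sum.elim (fun i : ℤ => (X (Sum.inl i) : MvPolynomial (ℤ ⊕ ℤ) ℝ)) (fun i : ℤ => -X (Sum.inr i))) (homogeneousComponent n u) = homogeneousComponent n u := fun n => by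
    rw [← theta_homogeneousComponent, heven]
  obtain ⟨hlow, hone⟩ := component_equations ω₂ lam β u hsplit (Nat.find hex) hmin
  rcases Nat.lt_trichotomy (Nat.find hex) 1 with h0 | h1 | h2
  · -- degree 0
    have e0 : Nat.find hex = 0 := by omega
    rw [e0] at hlow hn₀
    exact hn₀ (case_degree_zero ω₂ hω.ne' u hlow)
  · -- degree 1
    rw [h1] at hn₀
    exact case_degree_one hE hF ω₂ lam β hω hl (homogeneousComponent 1 u) (homogeneousComponent 3 u)
      (homogeneousComponent_isHomogeneous 1 u) (homogeneousComponent_isHomogeneous 3 u) (hevn 1) (hevn 3) hn₀ (hone h1)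
  · -- degree ≥ 2
    exact hn₀ (case_degree_high hC hD ω₂ hω.ne' (Nat.find hex) (by omega) _
      (homogeneousComponent_isHomogeneous _ u) hlow)

/-! ## The stub -/

/-- Window bound: every variable of `G` or `Ψ` sits at a site of absolute value at most the maximum
over the (finite) variable sets. -/
theorem vars_site_bound (G Ψ : MvPolynomial (ℤ ⊕ ℤ) ℝ) :
    (∀ v ∈ G.vars, Sum.elim id id v ∈ Set.Icc (-(((G.vars ∪ Ψ.vars).sup fun v => (Sum.elim id id v).natAbs : ℕ) : ℤ))
      ((G.vars ∪ Ψ.vars).sup fun v => (Sum.elim id id v).natAbs : ℕ)) ∧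
    (∀ v ∈ Ψ.vars, Sum.elim id id v ∈ Set.Icc (-(((G.vars ∪ Ψ.vars).sup fun v => (Sum.elim id id v).natAbs : ℕ) : ℤ))
      ((G.vars ∪ Ψ.vars).sup fun v => (Sum.elim id id v).natAbs : ℕ)) := by
  classical
  have key : ∀ v ∈ G.vars ∪ Ψ.vars, Sum.elim id id v ∈
      Set.Icc (-(((G.vars ∪ Ψ.vars).sup fun v => (Sum.elim id id v).natAbs : ℕ) : ℤ))
        ((G.vars ∪ Ψ.vars).sup fun v => (Sum.elim id id v).natAbs : ℕ) := by
    intro v hv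
    have hle : (Sum.elim id id v).natAbs ≤ (G.vars ∪ Ψ.vars).sup fun v => (Sum.elim id id v).natAbs :=
      Finset.le_sup (f := fun v => (Sum.elim id id v).natAbs) hv
    constructor <;> omega
  exact ⟨fun v hv => key v (Finset.mem_union_left _ hv), fun v hv => key v (Finset.mem_union_right _ hv)⟩

/-- **STUB G — `stub_mainReduction`** (crux `DressedCharge`, line `birth`): from the four spectral stubs
C–F, every momentum-odd solution `G` of a polynomial local conservation law `L G = Ψ - τΨ` of the pinned
anharmonic chain (`ω₂, lam, β > 0`) is a constant plus a shift-coboundary, `G = C c + H - τH`.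
Proof: Euler operators `u = E_p G`, `v = E_q G` over the window `[-M-1, M+1]`; the linearised equation
(helper 3), evenness of `u`, rigidity `u = 0` (above), hence `v = -L u = 0`, and exactness (helper 4). -/
theorem mainReduction_of_spectral :
    (∀ (ω₂ : ℝ) (n : ℕ) (w : MvPolynomial (ℤ ⊕ ℤ) ℂ), w.totalDegree ≤ n →
    ∀ P : Fin n → ℂ × ℂ, (∀ j, (P j).1 ≠ 0 ∧ (P j).2 ^ 2 = -((ω₂ : ℂ) + 2 - (P j).1 - ((P j).1)⁻¹)) →
      MvPolynomial.constantCoeff ((List.ofFn P).foldr (fun (Pj : ℂ × ℂ) (acc : MvPolynomial (ℤ ⊕ ℤ) ℂ) => MvPolynomial.mkDerivation ℂ (Sum.elim (fun x : ℤ => (MvPolynomial.C (Pj.1 ^ x) : MvPolynomial (ℤ ⊕ ℤ) ℂ)) (fun x : ℤ => MvPolynomial.C (Pj.2 * Pj.1 ^ x))) acc) ((MvPolynomial.mkDerivation ℂ (Sum.elim (fun i : ℤ => (MvPolynomial.X (Sum.inr i) : MvPolynomial (ℤ ⊕ ℤ) ℂ)) (fun i : ℤ => -(MvPolynomial.C ((ω₂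 : ℂ) + 2) * MvPolynomial.X (Sum.inl i)) + MvPolynomial.X (Sum.inl (i + 1)) + MvPolynomial.X (Sum.inl (i - 1))))) ((MvPolynomial.mkDerivation ℂ (Sum.elim (fun i : ℤ => (MvPolynomial.X (Sum.inr i) : MvPolynomial (ℤ ⊕ ℤ) ℂ)) (fun i : ℤ => -(MvPolynomial.C ((ω₂ : ℂ) + 2) * MvPolynomial.X (Sum.inl i)) + MvPolynomial.X (Sum.inl (i + 1)) + MvPolynomial.X (Sum.inl (i - 1))))) (w)) + (MvPolynomial.C ((ω₂ : ℂ) + 2) * (w) - MvPolynomial.rename (Sum.map (fun i : ℤ => i + 1) (fun i : ℤ => i + 1)) (w) - MvPolynomial.rename (Sum.map (fun i : ℤ => i - 1) (fun i : ℤ => i - 1)) (w)))) =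
        ((∑ j, (P j).2) ^ 2 + ((ω₂ : ℂ) + 2 - (∏ j, (P j).1) - (∏ j, (P j).1)⁻¹)) * MvPolynomial.constantCoeff ((List.ofFn P).foldr (fun (Pj : ℂ × ℂ) (acc : MvPolynomial (ℤ ⊕ ℤ) ℂ) => MvPolynomial.mkDerivation ℂ (Sum.elim (fun x : ℤ => (MvPolynomial.C (Pj.1 ^ x) : MvPolynomial (ℤ ⊕ ℤ) ℂ)) (fun x : ℤ => MvPolynomial.C (Pj.2 * Pj.1 ^ x))) acc) (w))) →
    (∀ (ω₂ : ℝ), ω₂ ≠ 0 → ∀ (n : ℕ), 2 ≤ n → ∀ (w : MvPolynomial (ℤ ⊕ ℤ) ℂ), w.IsHomogeneous n →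
      (∀ P : Fin n → ℂ × ℂ, (∀ j, (P j).1 ≠ 0 ∧ (P j).2 ^ 2 = -((ω₂ : ℂ) + 2 - (P j).1 - ((P j).1)⁻¹)) →
        ((∑ j, (P j).2) ^ 2 + ((ω₂ : ℂ) + 2 - (∏ j, (P j).1) - (∏ j, (P j).1)⁻¹)) * MvPolynomial.constantCoeff ((List.ofFn P).foldr (fun (Pj : ℂ × ℂ) (acc : MvPolynomial (ℤ ⊕ ℤ) ℂ) => MvPolynomial.mkDerivation ℂ (Sum.elim (fun x : ℤ => (MvPolynomial.C (Pj.1 ^ x) : MvPolynomial (ℤ ⊕ ℤ) ℂ)) (fun x : ℤ => MvPolynomial.C (Pj.2 * Pj.1 ^ x))) acc) (w)) = 0) →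
      w = 0) →
    (∀ (ω₂ lam β : ℝ) (a : ℤ →₀ ℂ) (u₃ : MvPolynomial (ℤ ⊕ ℤ) ℂ), u₃.totalDegree ≤ 3 →
      (MvPolynomial.mkDerivation ℂ (Sum.elim (fun i : ℤ => (MvPolynomial.X (Sum.inr i) : MvPolynomial (ℤ ⊕ ℤ) ℂ)) (fun i : ℤ => -(MvPolynomial.C ((ω₂ : ℂ) + 2) * MvPolynomial.X (Sum.inl i)) + MvPolynomial.X (Sum.inl (i + 1)) + MvPolynomial.X (Sum.inl (i - 1))))) ((MvPolynomial.mkDerivation ℂ (Sum.elim (fun i : ℤ => (MvPolynomial.X (Sum.inr i) : MvPolynomial (ℤ ⊕ ℤ) ℂ)) (fun i : ℤ => -(MvPolynomial.C ((ω₂ : ℂ) + 2) * MvPolynomial.X (Sum.inl i)) + MvPolynomial.X (Sum.inl (i + 1)) + MvPolynomial.X (Sum.inl (i - 1))))) (u₃)) + (MvPolynomial.C ((ω₂ : ℂ) + 2) * (u₃) - MvPolynomial.rename (Sum.map (fun i : ℤ => i + 1) (fun i : ℤ => i + 1)) (u₃) - MvPolynomial.rename (Sum.map (fun i : ℤ =>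 i - 1) (fun i : ℤ => i - 1)) (u₃)) + ((MvPolynomial.mkDerivation ℂ (Sum.elim (fun i : ℤ => (MvPolynomial.X (Sum.inr i) : MvPolynomial (ℤ ⊕ ℤ) ℂ)) (fun i : ℤ => -(MvPolynomial.C ((ω₂ : ℂ) + 2) * MvPolynomial.X (Sum.inl i)) + MvPolynomial.X (Sum.inl (i + 1)) + MvPolynomial.X (Sum.inl (i - 1))))) ((MvPolynomial.mkDerivation ℂ (Sum.elim (fun _ : ℤ => (0 : MvPolynomial (ℤ ⊕ ℤ) ℂ)) (fun i : ℤ => -(MvPolynomial.C (lam : ℂ) * MvPolynomial.X (Sum.inl i) ^ 3) + MvPolynomial.C (β : ℂ) * (MvPolynomial.X (Sum.inl (i + 1)) - MvPolynomial.X (Sum.inl i)) ^ 3 - MvPolynomial.C (β : ℂ) * (MvPolynomial.X (Sum.inl i) - MvPolynomial.X (Sum.inl (i - 1))) ^ 3))) (a.sum (fun m c => MvPolynomial.C c * MvPolynomial.X (Sum.inl m)))) + (MvPolynomial.mkDerivation ℂ (Sum.elim (fun _ : ℤ => (0 : MvPolynomial (ℤ ⊕ ℤ) ℂ)) (fun i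 : ℤ => -(MvPolynomial.C (lam : ℂ) * MvPolynomial.X (Sum.inl i) ^ 3) + MvPolynomial.C (β : ℂ) * (MvPolynomial.X (Sum.inl (i + 1)) - MvPolynomial.X (Sum.inl i)) ^ 3 - MvPolynomial.C (β : ℂ) * (MvPolynomial.X (Sum.inl i) - MvPolynomial.X (Sum.inl (i - 1))) ^ 3))) ((MvPolynomial.mkDerivation ℂ (Sum.elim (fun i : ℤ => (MvPolynomial.X (Sum.inr i) : MvPolynomial (ℤ ⊕ ℤ) ℂ)) (fun i : ℤ => -(MvPolynomial.C ((ω₂ : ℂ) + 2) * MvPolynomial.X (Sum.inl i)) + MvPolynomial.X (Sum.inl (i + 1)) + MvPolynomial.X (Sum.inl (i - 1))))) (a.sum (fun m c => MvPolynomial.C c * MvPolynomial.X (Sum.inl m)))) + ((MvPolynomial.C (3 * (lam : ℂ)) * MvPolynomial.X (Sum.inl 0) ^ 2 + MvPolynomial.C (3 * (β : ℂ)) * (MvPolynomial.X (Sum.inl 1) - MvPolynomial.X (Sum.inl 0)) ^ 2 + MvPolynomial.C (3 * (β : ℂ)) * (MvPolynomial.X (Sum.inl 0) - MvPolynomial.X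 (Sum.inl (-1))) ^ 2) * (a.sum (fun m c => MvPolynomial.C c * MvPolynomial.X (Sum.inl m))) - MvPolynomial.C (3 * (β : ℂ)) * (MvPolynomial.X (Sum.inl 1) - MvPolynomial.X (Sum.inl 0)) ^ 2 * MvPolynomial.rename (Sum.map (fun i : ℤ => i + 1) (fun i : ℤ => i + 1)) (a.sum (fun m c => MvPolynomial.C c * MvPolynomial.X (Sum.inl m))) - MvPolynomial.C (3 * (β : ℂ)) * (MvPolynomial.X (Sum.inl 0) - MvPolynomial.X (Sum.inl (-1))) ^ 2 * MvPolynomial.rename (Sum.map (fun i : ℤ => i - 1) (fun i : ℤ => i - 1)) (a.sum (fun m c => MvPolynomial.C c * MvPolynomial.X (Sum.inl m))))) = 0 →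
      ∀ P : Fin 3 → ℂ × ℂ, (∀ j, (P j).1 ≠ 0 ∧ (P j).2 ^ 2 = -((ω₂ : ℂ) + 2 - (P j).1 - ((P j).1)⁻¹)) →
        ((∑ j, (P j).2) ^ 2 + ((ω₂ : ℂ) + 2 - (∏ j, (P j).1) - (∏ j, (P j).1)⁻¹)) * MvPolynomial.constantCoeff ((List.ofFn P).foldr (fun (Pj : ℂ × ℂ) (acc : MvPolynomial (ℤ ⊕ ℤ) ℂ) => MvPolynomial.mkDerivation ℂ (Sum.elim (fun x : ℤ => (MvPolynomial.C (Pj.1 ^ x) : MvPolynomial (ℤ ⊕ ℤ) ℂ)) (fun x : ℤ => MvPolynomial.C (Pj.2 * Pj.1 ^ x))) acc) (u₃)) =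
          -(6 * (-(lam : ℂ) + (β : ℂ) * ∏ j, ((P j).1 - 1) - (β : ℂ) * ∏ j, (1 - ((P j).1)⁻¹))) *
            (a.sum (fun m c => c * (∏ j, (P j).1) ^ m) - ∑ j, a.sum (fun m c => c * ((P j).1) ^ m))) →
    (∀ (ω₂ : ℝ), 0 < ω₂ → ∀ (K : ℂ), K ≠ 0 → ∀ (a : ℤ →₀ ℂ), a ≠ 0 →
    ∀ c0 c12 c13 c23 : ℂ → ℂ → ℂ,
      (∀ f ∈ [c0, c12, c13, c23], ∃ (N : ℕ) (p : MvPolynomial (Fin 2) ℂ), ∀ z₁ z₂ : ℂ, z₁ ≠ 0 → z₂ ≠ 0 →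
          f z₁ z₂ * (z₁ * z₂) ^ N = MvPolynomial.eval ![z₁, z₂] p) →
      (∀ z₁ z₂ μ₁ μ₂ μ₃ : ℂ, z₁ ≠ 0 → z₂ ≠ 0 →
          μ₁ ^ 2 = -((ω₂ : ℂ) + 2 - (z₁) - (z₁)⁻¹) → μ₂ ^ 2 = -((ω₂ : ℂ) + 2 - (z₂) - (z₂)⁻¹) → μ₃ ^ 2 = -(ω₂ : ℂ) →
          ((μ₁ + μ₂ + μ₃) ^ 2 + ((ω₂ : ℂ) + 2 - (z₁ * z₂) - (z₁ * z₂)⁻¹)) *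
              (c0 z₁ z₂ + μ₁ * μ₂ * c12 z₁ z₂ + μ₁ * μ₃ * c13 z₁ z₂ + μ₂ * μ₃ * c23 z₁ z₂) =
            K * (a.sum (fun m c => c * (z₁ * z₂) ^ m) - a.sum (fun m c => c * (z₁) ^ m) - a.sum (fun m c => c * (z₂) ^ m) - a.sum (fun m c => c * ((1 : ℂ)) ^ m))) →
      False) →
    ∀ ω₂ lam β : ℝ, 0 < ω₂ → 0 < lam → 0 < β →
    ∀ G Ψ : MvPolynomial (ℤ ⊕ ℤ) ℝ,
      MvPolynomial.aeval (Sum.elim (fun i : ℤ => (MvPolynomial.X (Sum.inl i) : MvPolynomial (ℤ ⊕ ℤ) ℝ)) (fun i : ℤ => -MvPolynomial.X (Sum.inr i))) (G) = -G →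
      (MvPolynomial.mkDerivation ℝ (Sum.elim (fun i : ℤ => (MvPolynomial.X (Sum.inr i) : MvPolynomial (ℤ ⊕ ℤ) ℝ)) (fun i : ℤ => -(MvPolynomial.C ω₂ * MvPolynomial.X (Sum.inl i) + MvPolynomial.C lam * MvPolynomial.X (Sum.inl i) ^ 3) + ((MvPolynomial.X (Sum.inl (i + 1)) - MvPolynomial.X (Sum.inl i)) + MvPolynomial.C β * (MvPolynomial.X (Sum.inl (i + 1)) - MvPolynomial.X (Sum.inl i)) ^ 3) - ((MvPolynomial.X (Sum.inl i) - MvPolynomial.X (Sum.inl (i - 1))) + MvPolynomial.C β * (MvPolynomial.X (Sum.inl i) - MvPolynomial.X (Sum.inl (i - 1))) ^ 3)))) G = Ψ - MvPolynomial.rename (Sum.map (fun i : ℤ => i + 1) (fun i : ℤ => i + 1)) (Ψ) →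
      ∃ (c : ℝ) (H : MvPolynomial (ℤ ⊕ ℤ) ℝ), G = MvPolynomial.C c + H - MvPolynomial.rename (Sum.map (fun i : ℤ => i + 1) (fun i : ℤ => i + 1)) (H) := by
  intro hC hD hE hF ω₂ lam β hω hl _hβ G Ψ hΘ hL
  classical
  obtain ⟨hGb, hΨb⟩ := vars_site_bound G Ψ
  set M : ℕ := (G.vars ∪ Ψ.vars).sup fun v => (Sum.elim id id v).natAbs with hM
  obtain ⟨hv, hlin⟩ := linearised_of_law ω₂ lam β _ rfl G Ψ M hGb hΨb hL _ _ rfl rfl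
  have heven := eulerP_even_of_odd G (Finset.Icc (-(M : ℤ) - 1) (M + 1)) hΘ
  have hu0 := linearised_rigidity hC hD hE hF ω₂ lam β hω hl _ heven hlin
  rw [hu0, map_zero, neg_zero] at hv
  have hSq : ∀ k, Sum.inl k ∈ G.vars → k ∈ Finset.Icc (-(M : ℤ) - 1) (M + 1) := by
    intro k hk
    have := hGb _ hk
    simp only [Sum.elim_inl, id_eq, Set.mem_Icc] at this
    exact Finset.mem_Icc.mpr ⟨by omega, by omega⟩
  have hSp : ∀ k, Sum.inr k ∈ G.vars → k ∈ Finset.Icc (-(M : ℤ) - 1) (M + 1) := by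
    intro k hk
    have := hGb _ hk
    simp only [Sum.elim_inr, id_eq, Set.mem_Icc] at this
    exact Finset.mem_Icc.mpr ⟨by omega, by omega⟩
  exact exact_of_euler_zero G _ hSq hSp hv hu0

/-- **STUB G — `stub_mainReduction`** (registered core form; crux `DressedCharge`, line `birth`): every
momentum-odd solution `G` of a polynomial local conservation law `L G = Ψ - τΨ` of the pinned anharmonic
chain (`ω₂, lam, β > 0`) is a constant plus a shift-coboundary — by `mainReduction_of_spectral` fed with the
landed spectral stubs `stub_planeWaveLink`, `stub_harmonicSymmetries`, `stub_seedLink`, `stub_seedObstruction`. -/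
theorem stub_mainReduction :
    ∀ ω₂ lam β : ℝ, 0 < ω₂ → 0 < lam → 0 < β →
    ∀ G Ψ : MvPolynomial (ℤ ⊕ ℤ) ℝ,
      MvPolynomial.aeval (Sum.elim (fun i : ℤ => (MvPolynomial.X (Sum.inl i) : MvPolynomial (ℤ ⊕ ℤ) ℝ)) (fun i : ℤ => -MvPolynomial.X (Sum.inr i))) (G) = -G →
      (MvPolynomial.mkDerivation ℝ (Sum.elim (fun i : ℤ => (MvPolynomial.X (Sum.inr i) : MvPolynomial (ℤ ⊕ ℤ) ℝ)) (fun i : ℤ => -(MvPolynomial.C ω₂ * MvPolynomial.X (Sum.inl i) + MvPolynomial.C lam * MvPolynomial.X (Sum.inl i) ^ 3) + ((MvPolynomial.X (Sum.inl (i + 1)) - MvPolynomial.X (Sum.inl i)) + MvPolynomial.C β * (MvPolynomial.X (Sum.inl (i + 1)) - MvPolynomial.X (Sum.inl i)) ^ 3) - ((MvPolynomial.X (Sum.inl i) - MvPolynomial.X (Sum.inl (i - 1))) + MvPolynomial.C β * (MvPolynomial.X (Sum.inl i) - MvPolynomial.X (Sum.inl (i - 1))) ^ 3)))) G = Ψ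 - MvPolynomial.rename (Sum.map (fun i : ℤ => i + 1) (fun i : ℤ => i + 1)) (Ψ) →
      ∃ (c : ℝ) (H : MvPolynomial (ℤ ⊕ ℤ) ℝ), G = MvPolynomial.C c + H - MvPolynomial.rename (Sum.map (fun i : ℤ => i + 1) (fun i : ℤ => i + 1)) (H) :=
  fun ω₂ lam β hω hl hβ G Ψ hΘ hL => mainReduction_of_spectral stub_planeWaveLink stub_harmonicSymmetries
    stub_seedLink stub_seedObstruction ω₂ lam β hω hl hβ G Ψ hΘ hL

end Summit.AtomisticToContinuum.FouriersLaw.Theorems.DressedCharge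

end
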